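import Summits.AtomisticToContinuum.Crystallization.Theorems.ChartedZeroExcessLayeredLatticeLiouvilleZV

/-!
# Part ZZB «Sheet relabelling: shifting and flipping the layer index of a Barlow chart» (lens-2 g79, NODE 79 rider 11; imports ZV)

The last explicit symmetry the transverse endgame uses.  After Part ZZA the re-indexed partner map `G = φ ∘ g` satisfies the AFFINE LAYER LAW
`(G x).1 − s·x.1 = L` (`s = ±1`) on the inner window; clause (c) of `LinChartConcl` wants the target index to have FIRST COORDINATE EQUAL to the
source sheet.  Two more automorphisms of Barlow graphs do it: the LAYER SHIFT `shiftIdx L : (k, u) ↦ (k − L, u)` (letters `m ↦ τ (m + L)`) and the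
FLIP `flipIdx : (k, u) ↦ (−k, −u)` (letters `m ↦ τ (−m − 1)`; a cross bond read upward with letter `t` is the same bond read downward with letter `t`,
no letter negation).  `barlowAdj_shiftIdx_iff`, `barlowAdj_flip_iff` (via the codes of Part ZU: `−linkSite α β i` is a code of the swapped letter pair),
the chart transports `isBarlowBondChart_shift` / `isBarlowBondChart_flip` (+ coverage), and `exists_relabel_fst`: a relabelling `θ ∈ {shiftIdx L,
flipIdx ∘ shiftIdx L}` with `(θ (G x)).1 = x.1` wherever the layer law holds.  0 sorry.
-/

open Summit.AtomisticToContinuum.Crystallization.Theorems.ChartedPlanarOrderRigidityDoor (E3)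

namespace Summit.AtomisticToContinuum.Crystallization.Theorems.ChartedZeroExcessLayeredLatticeLiouville

/-! ## ZZB-1  The layer shift -/

/-- shift the layer index down by `L`. [this file, g79] -/
def shiftIdx (L : ℤ) (p : ℤ × ℤ × ℤ) : ℤ × ℤ × ℤ := (p.1 - L, p.2)

/-- … and up by `L` (the inverse). [this file, g79] -/
def unshiftIdx (L : ℤ) (p : ℤ × ℤ × ℤ) : ℤ × ℤ × ℤ := (p.1 + L, p.2)

/-- the shifted letter word. [this file, g79] -/
def shiftLetters (L : ℤ) (τ : ℤ → Bool) : ℤ → Bool := fun m => τ (m + L)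

/-- [formal bookkeeping] -/
theorem shiftIdx_unshiftIdx (L : ℤ) (p : ℤ × ℤ × ℤ) : shiftIdx L (unshiftIdx L p) = p := by
  simp [shiftIdx, unshiftIdx]

/-- [formal bookkeeping] -/
theorem unshiftIdx_shiftIdx (L : ℤ) (p : ℤ × ℤ × ℤ) : unshiftIdx L (shiftIdx L p) = p := by
  simp [shiftIdx, unshiftIdx]

/-- [formal bookkeeping] -/
theorem unshiftIdx_injective (L : ℤ) : Function.Injective (unshiftIdx L) :=
  fun p q h => by rw [← shiftIdx_unshiftIdx L p, h, shiftIdx_unshiftIdx]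

/-- ★ the layer shift is an isomorphism of Barlow graphs `B_τ ≅ B_{τ(· + L)}`. [this file, g79] -/
theorem barlowAdj_shiftIdx_iff (L : ℤ) (τ : ℤ → Bool) (p q : ℤ × ℤ × ℤ) :
    BarlowAdj (shiftLetters L τ) (shiftIdx L p) (shiftIdx L q) ↔ BarlowAdj τ p q := by
  have e1 : (shiftIdx L q).1 = (shiftIdx L p).1 ↔ q.1 = p.1 := by simp only [shiftIdx]; omega
  have e2 : (shiftIdx L q).1 = (shiftIdx L p).1 + 1 ↔ q.1 = p.1 + 1 := by simp only [shiftIdx]; omega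
  have e3 : (shiftIdx L p).1 = (shiftIdx L q).1 + 1 ↔ p.1 = q.1 + 1 := by simp only [shiftIdx]; omega
  have t1 : shiftLetters L τ (shiftIdx L p).1 = τ p.1 := by simp [shiftLetters, shiftIdx]
  have t2 : shiftLetters L τ (shiftIdx L q).1 = τ q.1 := by simp [shiftLetters, shiftIdx]
  rw [BarlowAdj, BarlowAdj, e1, e2, e3, t1, t2]
  simp only [shiftIdx]

/-- ★ chart transport under the shift: the new index `y` names the atom of old index `unshiftIdx L y`. [this file, g79] -/
theorem isBarlowBondChart_shift {C : Set E3} {D : Set (ℤ × ℤ × ℤ)} {Ψ : ℤ × ℤ × ℤ → E3} {τ : ℤ → Bool} (L : ℤ)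
    (h : IsBarlowBondChart C D Ψ τ) : IsBarlowBondChart C {y | unshiftIdx L y ∈ D} (Ψ ∘ unshiftIdx L) (shiftLetters L τ) := by
  obtain ⟨hinj, hmaps, hbond⟩ := h
  refine ⟨fun y hy y' hy' e => unshiftIdx_injective L (hinj hy hy' e), fun y hy => hmaps hy, fun y hy y' hy' => ?_⟩
  rw [Function.comp_apply, Function.comp_apply, hbond _ hy _ hy', ← barlowAdj_shiftIdx_iff L τ (unshiftIdx L y) (unshiftIdx L y'),
    shiftIdx_unshiftIdx, shiftIdx_unshiftIdx]

/-- [formal bookkeeping] -/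
theorem covers_shift {C : Set E3} {Ψ : ℤ × ℤ × ℤ → E3} (L : ℤ) (h : ∀ c ∈ C, ∃ z, Ψ z = c) : ∀ c ∈ C, ∃ y, (Ψ ∘ unshiftIdx L) y = c :=
  fun c hc => by
  obtain ⟨z, hz⟩ := h c hc
  exact ⟨shiftIdx L z, by rw [Function.comp_apply, unshiftIdx_shiftIdx, hz]⟩

/-! ## ZZB-2  The flip -/

/-- flip: negate the layer index and the in-sheet coordinates. [this file, g79] -/
def flipIdx (p : ℤ × ℤ × ℤ) : ℤ × ℤ × ℤ := (-p.1, -p.2)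

/-- the flipped letter word: the step between new layers `m, m + 1` is the old step between `−m − 1, −m`, read with the same letter. [this file, g79] -/
def flipLetters (τ : ℤ → Bool) : ℤ → Bool := fun m => τ (-m - 1)

/-- [formal bookkeeping] -/
theorem flipIdx_flipIdx (p : ℤ × ℤ × ℤ) : flipIdx (flipIdx p) = p := by
  simp [flipIdx]

/-- [formal bookkeeping] -/
theorem flipIdx_injective : Function.Injective flipIdx := fun p q h => by rw [← flipIdx_flipIdx p, h, flipIdx_flipIdx]

/-- [formal bookkeeping] -/
theorem flipLetters_flipLetters (τ : ℤ → Bool) : flipLetters (flipLetters τ) = τ := by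
  funext m
  simp only [flipLetters]
  congr 1
  ring

/-- [formal bookkeeping] -/
theorem flipIdx_shiftSite (v y : ℤ × ℤ × ℤ) : flipIdx (shiftSite v y) = shiftSite (flipIdx v) (-y) := by
  simp only [flipIdx, shiftSite, Prod.fst_neg, Prod.snd_neg, neg_add]

/-- the finite fact: the negative of a code of the letter pair `(α, β)` is a code of the swapped pair `(β, α)`. [formal bookkeeping] -/
theorem exists_neg_linkSite (α β : Bool) (i : Fin 12) : ∃ j : Fin 12, -linkSite α β i = linkSite β α j := by
  revert α β i; decide

/-- ★ the flip maps `B_τ` into `B_{flipLetters τ}`. [this file, g79] -/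
theorem barlowAdj_flip {τ : ℤ → Bool} {p q : ℤ × ℤ × ℤ} (h : BarlowAdj τ p q) : BarlowAdj (flipLetters τ) (flipIdx p) (flipIdx q) := by
  obtain ⟨i, rfl⟩ := exists_code_of_barlowAdj h
  obtain ⟨j, hj⟩ := exists_neg_linkSite (τ (p.1 - 1)) (τ p.1) i
  rw [flipIdx_shiftSite, hj]
  have h1 : flipLetters τ ((flipIdx p).1 - 1) = τ p.1 := by simp only [flipLetters, flipIdx]; congr 1; ring
  have h2 : flipLetters τ (flipIdx p).1 = τ (p.1 - 1) := by simp only [flipLetters, flipIdx]; congr 1; ring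
  have hb := barlowAdj_linkPt (flipLetters τ) (flipIdx p) j
  simp only [linkPt, h1, h2] at hb
  exact hb

/-- ★ the flip is an isomorphism of Barlow graphs `B_τ ≅ B_{flipLetters τ}`. [this file, g79] -/
theorem barlowAdj_flip_iff (τ : ℤ → Bool) (p q : ℤ × ℤ × ℤ) : BarlowAdj (flipLetters τ) (flipIdx p) (flipIdx q) ↔ BarlowAdj τ p q :=
  ⟨fun h => by
    have h' := barlowAdj_flip h
    rwa [flipLetters_flipLetters, flipIdx_flipIdx, flipIdx_flipIdx] at h', barlowAdj_flip⟩

/-- ★ chart transport under the flip: the new index `y` names the atom of old index `flipIdx y`. [this file, g79] -/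
theorem isBarlowBondChart_flip {C : Set E3} {D : Set (ℤ × ℤ × ℤ)} {Ψ : ℤ × ℤ × ℤ → E3} {τ : ℤ → Bool} (h : IsBarlowBondChart C D Ψ τ) :
    IsBarlowBondChart C {y | flipIdx y ∈ D} (Ψ ∘ flipIdx) (flipLetters τ) := by
  obtain ⟨hinj, hmaps, hbond⟩ := h
  refine ⟨fun y hy y' hy' e => flipIdx_injective (hinj hy hy' e), fun y hy => hmaps hy, fun y hy y' hy' => ?_⟩
  rw [Function.comp_apply, Function.comp_apply, hbond _ hy _ hy', ← barlowAdj_flip_iff τ (flipIdx y) (flipIdx y'), flipIdx_flipIdx,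
    flipIdx_flipIdx]

/-- [formal bookkeeping] -/
theorem covers_flip {C : Set E3} {Ψ : ℤ × ℤ × ℤ → E3} (h : ∀ c ∈ C, ∃ z, Ψ z = c) : ∀ c ∈ C, ∃ y, (Ψ ∘ flipIdx) y = c := fun c hc => by
  obtain ⟨z, hz⟩ := h c hc
  exact ⟨flipIdx z, by rw [Function.comp_apply, flipIdx_flipIdx, hz]⟩

/-! ## ZZB-3  ★ The relabelling that makes the target index read the source sheet -/

/-- [formal bookkeeping] -/
theorem shiftIdx_fst_of_layerLaw {G : ℤ × ℤ × ℤ → ℤ × ℤ × ℤ} {L : ℤ} {x : ℤ × ℤ × ℤ} (h : (G x).1 - 1 * x.1 = L) :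
    (shiftIdx L (G x)).1 = x.1 := by
  simp only [shiftIdx]; omega

/-- [formal bookkeeping] -/
theorem flipIdx_shiftIdx_fst_of_layerLaw {G : ℤ × ℤ × ℤ → ℤ × ℤ × ℤ} {L : ℤ} {x : ℤ × ℤ × ℤ} (h : (G x).1 - (-1) * x.1 = L) :
    (flipIdx (shiftIdx L (G x))).1 = x.1 := by
  simp only [flipIdx, shiftIdx]; omega

/-- ★ SHEET COMPATIBILITY FROM THE AFFINE LAYER LAW: with `L := (G y).1 − s·y.1` there is a relabelling `θ ∈ {shiftIdx L, flipIdx ∘ shiftIdx L}` of the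
target (an automorphism of Barlow graphs by ZZB-1/2) such that `(θ (G x)).1 = x.1` at every `x` where the layer law `(G x).1 − s·x.1 = (G y).1 − s·y.1`
holds — clause (c) of `LinChartConcl` in index form. [this file, g79] -/
theorem exists_relabel_fst (G : ℤ × ℤ × ℤ → ℤ × ℤ × ℤ) (y : ℤ × ℤ × ℤ) {s : ℤ} (hs : s = 1 ∨ s = -1) :
    ∃ θ : ℤ × ℤ × ℤ → ℤ × ℤ × ℤ, (θ = shiftIdx ((G y).1 - s * y.1) ∨ θ = flipIdx ∘ shiftIdx ((G y).1 - s * y.1)) ∧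
      ∀ x, (G x).1 - s * x.1 = (G y).1 - s * y.1 → (θ (G x)).1 = x.1 := by
  rcases hs with rfl | rfl
  · exact ⟨_, Or.inl rfl, fun x hx => shiftIdx_fst_of_layerLaw hx⟩
  · exact ⟨_, Or.inr rfl, fun x hx => flipIdx_shiftIdx_fst_of_layerLaw hx⟩

end Summit.AtomisticToContinuum.Crystallization.Theorems.ChartedZeroExcessLayeredLatticeLiouville
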